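import Mathlib
import Summits.KontsevichZagierPeriods.Zeta5Search.ClassDigitLawProof
import HarnessLib

/-!
# ζ(5) search — CLASS-DIGIT LAW, proofs III: the second digit `[ε¹] g_{x,q} = −p ĝ_q S₁(q)` and the `N = 2` reading

Cell `pub-zeta5`, track DENOM-LAW (D1; statements denom-theory-d1 g3/g4, proofs denom-theory-d1 g5, filed by denom-prover-d1 g4).
HONEST FRAMING: systematic search; identities and `p`-adic valuations of the cell's own partial-fraction coefficients
`c_{σ−1,q}` (rational numbers) in the window `p² > b₀ + 2`; nothing about ζ(5); no irrationality claim; records in print UNMOVED.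

This file proves `SecondDigit`, `SecondDigitCongruenceU`, `SecondDigitCongruenceW` of `ClassDigitLaw.lean`, verbatim from the certified
scratch monolith `denom-law/code/d1g5/lean/ClassDigitLawProof5.lean` (sha256 3ec15a59…): the logarithmic derivative of the foreign
product (`coeff_one_prod`, `coeff_one_foreignSeries`) gives `truncPole 2` in closed form (`truncPole_two`); the cell-level congruence sums
`SecondDigit` / `TopCoefficient` (exact at top order) / `leadingDigit_holds` / `clusterBound_holds` over the poles.
-/

noncomputable section

open Finset PowerSeries

namespace Summit.KontsevichZagierPeriods.Zeta5Search.ClassDigitLaw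

open Summit.KontsevichZagierPeriods.Zeta5Search.DualSeries (InBox)
open Summit.KontsevichZagierPeriods.Zeta5Search.CasoratianValuation (InPolytope)
open Summit.KontsevichZagierPeriods.Zeta5Search.WedgeDictionary (coeffU coeffW pfData)
open Summit.KontsevichZagierPeriods.Zeta5Search.ClusterValuation
open Summit.KontsevichZagierPeriods.Zeta5Search.PadicSeries
open Literature.NumberTheory.Transcendental.BallRivoal (harm)

/-! ## The second digit: `[ε¹] g_{x,q} = −p ĝ_q S₁(q)` and the `N = 2` reading in closed form -/

/-! ### `[X¹]` of products -/

/-- `[X¹](φψ) = φ(0)·[X¹]ψ + [X¹]φ·ψ(0)`. -/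
theorem coeff_one_mul' (φ ψ : PowerSeries ℚ) :
    coeff 1 (φ * ψ) = constantCoeff φ * coeff 1 ψ + coeff 1 φ * constantCoeff ψ := by
  have h := coeff_mul 1 φ ψ
  rw [Finset.Nat.sum_antidiagonal_eq_sum_range_succ_mk] at h
  simpa [Finset.sum_range_succ, coeff_zero_eq_constantCoeff_apply] using h

/-- `[X¹]` of a finite product with nonzero constant terms: `[X¹]∏F = (∏ F(0)) · Σ [X¹]F / F(0)` (the logarithmic derivative at `0`). -/
theorem coeff_one_prod {ι : Type*} [DecidableEq ι] (S : Finset ι) (F : ι → PowerSeries ℚ)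
    (hF : ∀ s ∈ S, constantCoeff (F s) ≠ 0) :
    coeff 1 (∏ s ∈ S, F s) = (∏ s ∈ S, constantCoeff (F s)) * ∑ s ∈ S, coeff 1 (F s) / constantCoeff (F s) := by
  induction S using Finset.induction_on with
  | empty => simp
  | insert a S ha ih =>
    have hFa : constantCoeff (F a) ≠ 0 := hF a (mem_insert_self a S)
    have hFS : ∀ s ∈ S, constantCoeff (F s) ≠ 0 := fun s hs => hF s (mem_insert_of_mem hs)
    rw [prod_insert ha, prod_insert ha, sum_insert ha, coeff_one_mul', ih hFS, map_prod]
    field_simp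
    ring

/-- Constant term of a rescaled binomial series: `δ^e`. -/
theorem constantCoeff_rescale_binomSeries (a δ : ℚ) (e : ℤ) :
    constantCoeff (rescale a (binomSeries δ e)) = δ ^ e := by
  rw [← coeff_zero_eq_constantCoeff_apply, coeff_rescale, coeff_binomSeries, Ring.choose_zero_right]
  simp

/-- `[X¹]` of a rescaled binomial series: `a·e·δ^{e−1}`. -/
theorem coeff_one_rescale_binomSeries (a δ : ℚ) (e : ℤ) :
    coeff 1 (rescale a (binomSeries δ e)) = a * (e : ℚ) * δ ^ (e - 1) := by
  rw [coeff_rescale, coeff_binomSeries, Ring.choose_one_right, pow_one]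
  push_cast
  ring

/-- **`[ε¹] g_{x,q} = −p · ĝ_q · S₁(q)`** (`0 ≤ b₀`, `q ≤ b₀`; the logarithmic derivative of the foreign product at `ε = 0`). -/
theorem coeff_one_foreignSeries (b : ℕ → ℤ) {p q : ℕ} (hq : q ≤ (b 0).toNat) :
    coeff 1 (foreignSeries b p q) = -(p : ℚ) * gHat b p q * foreignS1 b p q := by
  have hδ : ∀ s ∈ (range ((b 0).toNat + 1)).filter (fun s => s % p ≠ q % p), ((s : ℚ) - q) ≠ 0 := by
    intro s hs
    have hne : s ≠ q := by rintro rfl; exact (mem_filter.1 hs).2 rfl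
    exact sub_ne_zero.2 (by exact_mod_cast hne)
  have hF0 : ∀ s ∈ (range ((b 0).toNat + 1)).filter (fun s => s % p ≠ q % p),
      constantCoeff (rescale (-(p : ℚ)) (binomSeries ((s : ℚ) - q) (netExp b s))) ≠ 0 := by
    intro s hs
    rw [constantCoeff_rescale_binomSeries]
    exact zpow_ne_zero _ (hδ s hs)
  have hP0' : ∏ s ∈ (range ((b 0).toNat + 1)).filter (fun s => s % p ≠ q % p),
      constantCoeff (rescale (-(p : ℚ)) (binomSeries ((s : ℚ) - q) (netExp b s))) =
      ∏ s ∈ (range ((b 0).toNat + 1)).filter (fun s => s % p ≠ q % p), ((s : ℚ) - q) ^ netExp b s :=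
    prod_congr rfl (fun s _ => constantCoeff_rescale_binomSeries _ _ _)
  have hP0 : constantCoeff (∏ s ∈ (range ((b 0).toNat + 1)).filter (fun s => s % p ≠ q % p),
      rescale (-(p : ℚ)) (binomSeries ((s : ℚ) - q) (netExp b s))) =
      ∏ s ∈ (range ((b 0).toNat + 1)).filter (fun s => s % p ≠ q % p), ((s : ℚ) - q) ^ netExp b s := by
    rw [map_prod, hP0']
  have hP1 : coeff 1 (∏ s ∈ (range ((b 0).toNat + 1)).filter (fun s => s % p ≠ q % p),
      rescale (-(p : ℚ)) (binomSeries ((s : ℚ) - q) (netExp b s))) =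
      (∏ s ∈ (range ((b 0).toNat + 1)).filter (fun s => s % p ≠ q % p), ((s : ℚ) - q) ^ netExp b s) *
        (-(p : ℚ) * ∑ s ∈ (range ((b 0).toNat + 1)).filter (fun s => s % p ≠ q % p),
          (netExp b s : ℚ) / ((s : ℚ) - q)) := by
    rw [coeff_one_prod _ _ hF0, hP0']
    congr 1
    rw [mul_sum]
    refine sum_congr rfl (fun s hs => ?_)
    have hδs := hδ s hs
    rw [coeff_one_rescale_binomSeries, constantCoeff_rescale_binomSeries, zpow_sub_one₀ hδs]
    field_simp
  have _hq := hq
  rw [foreignSeries, two_eq_C, gHat, foreignS1]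
  by_cases hc : ¬ (2 : ℤ) ∣ b 0 ∧ ¬ CentreIn b p q
  · have hδc : ((b 0 : ℚ)) / 2 - q ≠ 0 := by
      intro h
      apply hc.1
      have h2 : ((b 0 : ℤ) : ℚ) = 2 * (q : ℚ) := by linarith
      have hz : b 0 = 2 * (q : ℤ) := by exact_mod_cast h2
      exact ⟨(q : ℤ), hz⟩
    rw [if_pos hc, if_pos hc, if_pos hc, coeff_one_mul', map_mul, constantCoeff_C, coeff_C_mul, hP0, hP1,
      constantCoeff_rescale_binomSeries, coeff_one_rescale_binomSeries, zpow_one, sub_self, zpow_zero,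
      Int.cast_one]
    linear_combination (2 * (p : ℚ) *
      ∏ s ∈ (range ((b 0).toNat + 1)).filter (fun s => s % p ≠ q % p), ((s : ℚ) - q) ^ netExp b s) *
        mul_one_div_cancel hδc
  · rw [if_neg hc, if_neg hc, if_neg hc]
    simp only [mul_one, add_zero]
    rw [coeff_C_mul, hP1]
    ring

/-- `↑(trunc₂ φ) = φ(0) + [X¹]φ · X` as a power series. -/
theorem coe_trunc_two (φ : PowerSeries ℚ) :
    ((trunc 2 φ : Polynomial ℚ) : PowerSeries ℚ) = C (constantCoeff φ) + C (coeff 1 φ) * X ^ 1 := by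
  ext m
  rw [Polynomial.coeff_coe, coeff_trunc, map_add, coeff_C, coeff_C_mul_X_pow, ← coeff_zero_eq_constantCoeff_apply]
  rcases Nat.lt_or_ge m 2 with hm | hm
  · interval_cases m <;> simp
  · rw [if_neg (by omega), if_neg (by omega), if_neg (by omega), add_zero]

/-- The depth-`2` truncated pole in closed form: `truncPole 2 = (−p)^{σ+E} ĝ_q (ρ_{q,σ} − p S₁(q) ρ_{q,σ+1})` (`σ + 1 ≤ n_q`). -/
theorem truncPole_two (b : ℕ → ℤ) {p : ℕ} (hprime : p.Prime) (h0 : 0 ≤ b 0) {q : ℕ} (hq : q ≤ (b 0).toNat)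
    {σ : ℕ} (hσ : (σ : ℤ) + 1 ≤ -netExp b q) :
    truncPole 2 b p q σ = (-(p : ℚ)) ^ ((σ : ℤ) + classExp b p q) * gHat b p q *
      (classRho b p q σ - (p : ℚ) * foreignS1 b p q * classRho b p q (σ + 1)) := by
  obtain ⟨k, hk⟩ : ∃ k, (-netExp b q).toNat - σ = k + 1 := ⟨(-netExp b q).toNat - σ - 1, by omega⟩
  have hk' : (-netExp b q).toNat - (σ + 1) = k := by omega
  rw [truncPole, coe_trunc_two, mul_add, map_add, coeff_mul_C, ← mul_assoc, coeff_mul_X_pow',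
    if_pos (by omega), coeff_mul_C, constantCoeff_foreignSeries b hprime h0 hq, coeff_one_foreignSeries b hq,
    classRho, classRho, hk', hk, Nat.add_sub_cancel]
  ring

/-- **`SecondDigit` is a theorem.** -/
theorem secondDigit_holds : SecondDigit := by
  intro b p q σ hb hprime hp5 hwin hq hσ1 hσ hne
  haveI : Fact p.Prime := ⟨hprime⟩
  obtain ⟨hbox, -, -, -⟩ := thmA_data b hb hwin
  have h2 := pole_sub_truncPole_bound 2 b hb hprime hp5 hwin hq hσ1 (by omega)
  rw [truncPole_two b hprime hbox.1 hq hσ] at h2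
  exact val_ge_of_padicNorm_le hne (h2.trans_eq (by norm_num))

/-- **The second digit congruence for the order-`σ` coefficient sum** (`σ = 5`: `U`; `σ = 3`: `W`). -/
theorem secondDigitCongruence (b : ℕ → ℤ) {p : ℕ} (m : ℤ) {σ : ℕ} (hb : InPolytope b) (hprime : p.Prime)
    (hp5 : 5 ≤ p) (hwin : (b 0 + 2 : ℤ) < (p : ℤ) ^ 2) (hσ1 : 1 ≤ σ) (hσ6 : σ ≤ 6)
    (hm : ∀ q, q ≤ (b 0).toNat → netExp b q ≤ -(σ : ℤ) → m ≤ (σ : ℤ) + classExp b p q)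
    (hne : (∑ q ∈ range ((b 0).toNat + 1), pfData b (σ - 1) q) - (-(p : ℚ)) ^ m * digitSum2 b p σ m ≠ 0) :
    m + 2 ≤ padicValRat p
      ((∑ q ∈ range ((b 0).toNat + 1), pfData b (σ - 1) q) - (-(p : ℚ)) ^ m * digitSum2 b p σ m) := by
  haveI : Fact p.Prime := ⟨hprime⟩
  have hp0 : (p : ℚ) ≠ 0 := Nat.cast_ne_zero.2 hprime.ne_zero
  have hp' : (-(p : ℚ)) ≠ 0 := neg_ne_zero.2 hp0
  refine val_ge_of_padicNorm_le hne ?_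
  rw [digitSum2, sum_filter, sum_filter, mul_add, mul_sum, mul_sum, ← sum_add_distrib, ← sum_sub_distrib]
  refine padicNorm.sum_le' (fun q hq => ?_) (zpow_p_nonneg _)
  have hq' : q ≤ (b 0).toNat := Nat.lt_succ_iff.1 (mem_range.1 hq)
  by_cases hA : netExp b q ≤ -(σ : ℤ)
  · have hmq := hm q hq' hA
    -- Theorem B in norm form
    have hLD : padicNorm p (pfData b (σ - 1) q -
        (-(p : ℚ)) ^ ((σ : ℤ) + classExp b p q) * gHat b p q * classRho b p q σ) ≤
        (p : ℚ) ^ (-((σ : ℤ) + classExp b p q + 1)) :=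
      padicNorm_le_of_val fun hne0 => leadingDigit_holds b p q σ hb hprime hp5 hwin hq' hσ1 (by omega) hne0
    by_cases hB : (σ : ℤ) + classExp b p q = m
    · rw [if_pos ⟨hA, hB⟩, if_neg (fun h => by omega)]
      simp only [mul_zero, add_zero]
      by_cases hS : (σ : ℤ) + 1 ≤ -netExp b q
      · -- two digits: `SecondDigit`
        rw [classRhoNext, if_pos hS, ← hB]
        have h2 : padicNorm p (pfData b (σ - 1) q - (-(p : ℚ)) ^ ((σ : ℤ) + classExp b p q) * gHat b p q *
            (classRho b p q σ - (p : ℚ) * foreignS1 b p q * classRho b p q (σ + 1))) ≤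
            (p : ℚ) ^ (-((σ : ℤ) + classExp b p q + 2)) :=
          padicNorm_le_of_val fun hne0 => secondDigit_holds b p q σ hb hprime hp5 hwin hq' hσ1 hS hne0
        have e : pfData b (σ - 1) q - (-(p : ℚ)) ^ ((σ : ℤ) + classExp b p q) * (gHat b p q *
            (classRho b p q σ - (p : ℚ) * foreignS1 b p q * classRho b p q (σ + 1))) =
            pfData b (σ - 1) q - (-(p : ℚ)) ^ ((σ : ℤ) + classExp b p q) * gHat b p q *
              (classRho b p q σ - (p : ℚ) * foreignS1 b p q * classRho b p q (σ + 1)) := by ring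
        rw [e]
        exact h2
      · -- top order `σ = n_q`: `TopCoefficient` is exact
        rw [classRhoNext, if_neg hS]
        simp only [mul_zero, sub_zero]
        have hσn : (-netExp b q).toNat = σ := by omega
        have htop := topCoefficient_holds b p q hb hprime hp5 hwin hq' (by omega)
        rw [hσn] at htop
        have hexp : -netExp b q + classExp b p q = m := by omega
        rw [hexp] at htop
        have e0 : pfData b (σ - 1) q - (-(p : ℚ)) ^ m * (gHat b p q * classRho b p q σ) = 0 := by
          rw [htop]; ring
        rw [e0, padicNorm.zero]
        exact zpow_p_nonneg _
    · by_cases hB1 : (σ : ℤ) + classExp b p q = m + 1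
      · -- one digit, one level up: `LeadingDigit`
        rw [if_neg (fun h => hB h.2), if_pos ⟨hA, hB1⟩]
        simp only [mul_zero, zero_add]
        have e : pfData b (σ - 1) q - (-(p : ℚ)) ^ m * (-(p : ℚ) * gHat b p q * classRho b p q σ) =
            pfData b (σ - 1) q - (-(p : ℚ)) ^ ((σ : ℤ) + classExp b p q) * gHat b p q * classRho b p q σ := by
          rw [hB1, zpow_add_one₀ hp']
          ring
        rw [e]
        exact hLD.trans (zpow_le_zpow_right₀ one_le_p (by omega))
      · -- two or more levels up: `ClusterBound`
        rw [if_neg (fun h => hB h.2), if_neg (fun h => hB1 h.2)]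
        simp only [mul_zero, add_zero, sub_zero]
        have hc : padicNorm p (pfData b (σ - 1) q) ≤ (p : ℚ) ^ (-((σ : ℤ) + classExp b p q)) := by
          refine padicNorm_le_of_val fun hc0 => ?_
          have hA' := clusterBound_holds b p q (σ - 1) hb hprime (by omega) hwin hq' (by omega) hc0
          have hcast : (((σ - 1 : ℕ) : ℤ)) = (σ : ℤ) - 1 := by omega
          rw [hcast] at hA'
          linarith
        exact hc.trans (zpow_le_zpow_right₀ one_le_p (by omega))
  · have hc0 := pfData_eq_zero_of_lt b hb hwin hq' hσ1 hσ6 hA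
    rw [hc0, if_neg (fun h => hA h.1), if_neg (fun h => hA h.1)]
    simp only [mul_zero, add_zero, sub_zero, padicNorm.zero]
    exact zpow_p_nonneg _

/-- **`SecondDigitCongruenceU` is a theorem.** -/
theorem secondDigitCongruenceU_holds : SecondDigitCongruenceU := by
  intro b p m hb hprime hp5 hwin hm hne
  have hm' : ∀ q, q ≤ (b 0).toNat → netExp b q ≤ -((5 : ℕ) : ℤ) → m ≤ ((5 : ℕ) : ℤ) + classExp b p q :=
    fun q hq h => by have := hm q hq (by exact_mod_cast h); exact_mod_cast this
  exact secondDigitCongruence b m (σ := 5) hb hprime hp5 hwin (by norm_num) (by norm_num) hm' hne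

/-- **`SecondDigitCongruenceW` is a theorem.** -/
theorem secondDigitCongruenceW_holds : SecondDigitCongruenceW := by
  intro b p m hb hprime hp5 hwin hm hne
  have hm' : ∀ q, q ≤ (b 0).toNat → netExp b q ≤ -((3 : ℕ) : ℤ) → m ≤ ((3 : ℕ) : ℤ) + classExp b p q :=
    fun q hq h => by have := hm q hq (by exact_mod_cast h); exact_mod_cast this
  exact secondDigitCongruence b m (σ := 3) hb hprime hp5 hwin (by norm_num) (by norm_num) hm' hne


end Summit.KontsevichZagierPeriods.Zeta5Search.ClassDigitLaw

end
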